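import Summits.CriticalPhenomena.PercolationContinuityZ3.Theorems.SahiMasterFamilyFIneqAllThirdEvents
import Summits.CriticalPhenomena.PercolationContinuityZ3.Theorems.SahiMasterFamilyEqPrincipal
import HarnessLib

/-!
# `E₃ = F + R`: Kahn's `C₃` as THEOREM F plus one signed remainder; a measure-level proved region

Unit `prim-master-conj` (crux anchor stmt-CriticalPhenomena-4575, helper work), gen 30; memo
`run/shared/lean/prim/prim-l12/prim-master-conj/POINTWISE.md` §31.

THEOREM F (`SahiFCombBridge.fIneq_nonneg`, seat bnk-2 gen 21 + this unit's gens 20–24) says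
`F(A,B;C) := (1 + μC)·μ(A∩B∩C) − μC·μ(A∩B) − μ(A∩C)·μ(B∩C) ≥ 0` for increasing `A, B, C` and every product measure.
Sahi's third functional on the same events is `E₃(A,B,C) = 2μ(ABC) − μ(AB)μC − μ(AC)μB − μ(BC)μA + μAμBμC`.

* `sahiE_three_ind_eq_fIneq_add` — the RING IDENTITY (any weight `μ`)
  **`E₃(A,B,C) = F(A,B;C) + (1 − μC)·(μ(A∩B∩C) − μA·μB) + (μA − μ(A∩C))·(μB − μ(B∩C))`.**
* `sahiE_three_ind_ge_of_upperSet` — hence, for increasing events under a product measure,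
  **`E₃(A,B,C) ≥ −(1 − μC)·(μA·μB − μ(A∩B∩C))`** (THEOREM F plus `μ(A∩C) ≤ μA`, `μ(B∩C) ≤ μB`): Sahi's cubic functional of three
  increasing events is never more negative than the "pair-versus-triple deficit" of any two of them damped by the co-measure of the third.
* **`sahiE_three_ind_nonneg_of_mul_le_inter₃`** — KAHN'S CONJECTURE 5 / `MasterFamilyNonneg 3` ON THE REGION `μA·μB ≤ μ(A∩B∩C)`:
  if the common intersection of three increasing events is at least as likely as the product of two of the marginals, then `E₃ ≥ 0`
  (indeed `E₃ ≥ F ≥ 0`).  `…_of_exists_pair` is the symmetric packaging (any two of the three marginals).  This region strictly contains the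
  tree's MEET-CONTAINMENT stratum (`SahiClassTCube.sahiE_three_nonneg_of_inter_subset_two`: `A ∩ B ⊆ C`, where `μ(ABC) = μ(AB) ≥ μAμB` by
  Harris — `mul_le_inter₃_of_inter_subset`), but it is a condition on the PARAMETER `p`, not on the triple alone.
HONEST FRAMING: a two-line consequence of THEOREM F; `C₃` / Kahn's Conjecture 5 in general remains OPEN.  The complementary statement
"for every triple SOME labelling has a nonnegative remainder" is FALSE (m = 4: `A = x₂(x₀∨x₁)`, `B = x₁x₃(x₀∨x₂)`, `C = x₀(x₁∨x₂∨x₃)`,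
`p = (9/10, 9/10, 5/7, 1/2)`: all three remainders `< 0`, `E₃ = 4131/17150000 > 0`), and the LP verdict of gen 20 (POINTWISE §21.4,
kit j144557: `E₃ ∉ cone{moments × F, Harris, cells}`) stands. [this work]
-/

noncomputable section

open scoped Classical

namespace Summit.CriticalPhenomena.PercolationContinuityZ3.Theorems

namespace SahiE3FSplit

open Finset Function
open Literature.Combinatorics.Sahi2008
open Literature.Probability.Percolation.DecisionTree (ind ind_nonneg ind_of_mem ind_of_not_mem)

variable {ι : Type} [Fintype ι]

local notation3 (prettyPrint := false) "μ⟦" q ", " X "⟧" => ex (bernoulliWeight q) (ind X)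

/-! ### 1. The ring identity `E₃ = F + R` -/

/-- **`E₃(A,B,C) = F(A,B;C) + (1 − μC)(μ(ABC) − μAμB) + (μA − μ(AC))(μB − μ(BC))`** — a polynomial identity in the seven
moments, valid for every weight. [this work] -/
theorem sahiE_three_ind_eq_fIneq_add (μ : Set ι → ℝ) (A B C : Set (Set ι)) :
    sahiE μ 3 ![ind A, ind B, ind C]
      = ((1 + ex μ (ind C)) * ex μ (ind (A ∩ B ∩ C)) - ex μ (ind C) * ex μ (ind (A ∩ B))
          - ex μ (ind (A ∩ C)) * ex μ (ind (B ∩ C)))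
        + ((1 - ex μ (ind C)) * (ex μ (ind (A ∩ B ∩ C)) - ex μ (ind A) * ex μ (ind B))
          + (ex μ (ind A) - ex μ (ind (A ∩ C))) * (ex μ (ind B) - ex μ (ind (B ∩ C)))) := by
  rw [sahiE_three, ind_mul_ind_eq_inter, ind_mul_ind_eq_inter, ind_mul_ind_eq_inter, ind_mul_ind_eq_inter]
  ring

/-! ### 2. Consequences of THEOREM F for increasing events -/

/-- `μ(X ∩ Y) ≤ μ(X)` for events under a product measure. [folklore] -/
theorem ex_ind_inter_le_left (p : ι → unitInterval) (X Y : Set (Set ι)) : μ⟦p, X ∩ Y⟧ ≤ μ⟦p, X⟧ :=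
  ex_mono (isFKGMeasure_bernoulliWeight p).nonneg fun ω => by
    by_cases h : ω ∈ X ∩ Y
    · rw [ind_of_mem h, ind_of_mem h.1]
    · rw [ind_of_not_mem h]; exact ind_nonneg X ω

/-- `μ(X) ≤ 1` for events under a product measure. [folklore] -/
theorem ex_ind_le_one (p : ι → unitInterval) (X : Set (Set ι)) : μ⟦p, X⟧ ≤ 1 := by
  have h1 : ex (bernoulliWeight p) (1 : Set ι → ℝ) = 1 := ex_one (sum_bernoulliWeight p)
  calc μ⟦p, X⟧ ≤ ex (bernoulliWeight p) (1 : Set ι → ℝ) :=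
        ex_mono (isFKGMeasure_bernoulliWeight p).nonneg fun ω => by
          by_cases h : ω ∈ X
          · rw [ind_of_mem h]; exact le_rfl
          · rw [ind_of_not_mem h]; exact zero_le_one
    _ = 1 := h1

/-- **Lower bound for Sahi's cubic functional of three increasing events** (THEOREM F + two monotonicities):
`E₃(A,B,C) ≥ −(1 − μC)·(μA·μB − μ(A∩B∩C))`. [this work] -/
theorem sahiE_three_ind_ge_of_upperSet (p : ι → unitInterval) {A B C : Set (Set ι)}
    (hA : IsUpperSet A) (hB : IsUpperSet B) (hC : IsUpperSet C) :
    -((1 - μ⟦p, C⟧) * (μ⟦p, A⟧ * μ⟦p, B⟧ - μ⟦p, A ∩ B ∩ C⟧))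
      ≤ sahiE (bernoulliWeight p) 3 ![ind A, ind B, ind C] := by
  rw [sahiE_three_ind_eq_fIneq_add]
  have hF := SahiFCombBridge.fIneq_nonneg p A B C hA hB hC
  have hAC : μ⟦p, A ∩ C⟧ ≤ μ⟦p, A⟧ := ex_ind_inter_le_left p A C
  have hBC : μ⟦p, B ∩ C⟧ ≤ μ⟦p, B⟧ := ex_ind_inter_le_left p B C
  have hprod : 0 ≤ (μ⟦p, A⟧ - μ⟦p, A ∩ C⟧) * (μ⟦p, B⟧ - μ⟦p, B ∩ C⟧) :=
    mul_nonneg (sub_nonneg.2 hAC) (sub_nonneg.2 hBC)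
  nlinarith [hF, hprod]

/-- **`E₃ ≥ F(A,B;C) ≥ 0` whenever `μA·μB ≤ μ(A∩B∩C)`** (the remainder is then a sum of two nonnegative terms). [this work] -/
theorem sahiE_three_ind_ge_fIneq_of_mul_le_inter₃ (p : ι → unitInterval) {A B C : Set (Set ι)}
    (hle : μ⟦p, A⟧ * μ⟦p, B⟧ ≤ μ⟦p, A ∩ B ∩ C⟧) :
    (1 + μ⟦p, C⟧) * μ⟦p, A ∩ B ∩ C⟧ - μ⟦p, C⟧ * μ⟦p, A ∩ B⟧ - μ⟦p, A ∩ C⟧ * μ⟦p, B ∩ C⟧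
      ≤ sahiE (bernoulliWeight p) 3 ![ind A, ind B, ind C] := by
  rw [sahiE_three_ind_eq_fIneq_add]
  have hC1 : μ⟦p, C⟧ ≤ 1 := ex_ind_le_one p C
  have hAC : μ⟦p, A ∩ C⟧ ≤ μ⟦p, A⟧ := ex_ind_inter_le_left p A C
  have hBC : μ⟦p, B ∩ C⟧ ≤ μ⟦p, B⟧ := ex_ind_inter_le_left p B C
  have h1 : 0 ≤ (1 - μ⟦p, C⟧) * (μ⟦p, A ∩ B ∩ C⟧ - μ⟦p, A⟧ * μ⟦p, B⟧) :=
    mul_nonneg (sub_nonneg.2 hC1) (sub_nonneg.2 hle)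
  have h2 : 0 ≤ (μ⟦p, A⟧ - μ⟦p, A ∩ C⟧) * (μ⟦p, B⟧ - μ⟦p, B ∩ C⟧) :=
    mul_nonneg (sub_nonneg.2 hAC) (sub_nonneg.2 hBC)
  linarith

/-- **KAHN'S CONJECTURE 5 ON THE REGION `μA·μB ≤ μ(A∩B∩C)`.**  For increasing `A, B, C` and a product measure `μ_p` with
`μ_p(A)·μ_p(B) ≤ μ_p(A ∩ B ∩ C)`:  `E₃(μ_p; A, B, C) ≥ 0`. [this work] -/
theorem sahiE_three_ind_nonneg_of_mul_le_inter₃ (p : ι → unitInterval) {A B C : Set (Set ι)}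
    (hA : IsUpperSet A) (hB : IsUpperSet B) (hC : IsUpperSet C) (hle : μ⟦p, A⟧ * μ⟦p, B⟧ ≤ μ⟦p, A ∩ B ∩ C⟧) :
    0 ≤ sahiE (bernoulliWeight p) 3 ![ind A, ind B, ind C] :=
  le_trans (SahiFCombBridge.fIneq_nonneg p A B C hA hB hC) (sahiE_three_ind_ge_fIneq_of_mul_le_inter₃ p hle)

/-- The region contains the tree's MEET-CONTAINMENT stratum: `A ∩ B ⊆ C ⟹ μA·μB ≤ μ(A∩B∩C)` (Harris), for EVERY `p`. [this work] -/
theorem mul_le_inter₃_of_inter_subset (p : ι → unitInterval) {A B C : Set (Set ι)} (hA : IsUpperSet A) (hB : IsUpperSet B)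
    (h : A ∩ B ⊆ C) : μ⟦p, A⟧ * μ⟦p, B⟧ ≤ μ⟦p, A ∩ B ∩ C⟧ := by
  rw [Set.inter_eq_left.2 h]
  exact harris_ex_ind p hA hB

/-! ### 3. Symmetric packaging: any two of the three marginals -/

/-- `E₃` is invariant under the transposition of the last two slots. [folklore] -/
theorem sahiE_three_ind_swap₁₂ (μ : Set ι → ℝ) (A B C : Set (Set ι)) :
    sahiE μ 3 ![ind A, ind C, ind B] = sahiE μ 3 ![ind A, ind B, ind C] := by
  rw [sahiE_three, sahiE_three]
  have e1 : ind A * ind C * ind B = ind A * ind B * ind C := by ring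
  have e2 : ind C * ind B = ind B * ind C := by ring
  rw [e1, e2]
  ring

/-- `E₃` is invariant under the 3-cycle bringing the last slot to the front. [folklore] -/
theorem sahiE_three_ind_cycle (μ : Set ι → ℝ) (A B C : Set (Set ι)) :
    sahiE μ 3 ![ind B, ind C, ind A] = sahiE μ 3 ![ind A, ind B, ind C] := by
  rw [sahiE_three, sahiE_three]
  have e1 : ind B * ind C * ind A = ind A * ind B * ind C := by ring
  have e2 : ind C * ind A = ind A * ind C := by ring
  have e3 : ind B * ind A = ind A * ind B := by ring
  rw [e1, e2, e3]
  ring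

/-- **`C₃` whenever the triple intersection dominates the product of SOME two marginals.**  For increasing `A, B, C` under `μ_p`:
if `μA·μB ≤ μ(ABC)` or `μA·μC ≤ μ(ABC)` or `μB·μC ≤ μ(ABC)` then `E₃(μ_p; A,B,C) ≥ 0`. [this work] -/
theorem sahiE_three_ind_nonneg_of_exists_pair (p : ι → unitInterval) {A B C : Set (Set ι)}
    (hA : IsUpperSet A) (hB : IsUpperSet B) (hC : IsUpperSet C)
    (h : μ⟦p, A⟧ * μ⟦p, B⟧ ≤ μ⟦p, A ∩ B ∩ C⟧ ∨ μ⟦p, A⟧ * μ⟦p, C⟧ ≤ μ⟦p, A ∩ B ∩ C⟧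
      ∨ μ⟦p, B⟧ * μ⟦p, C⟧ ≤ μ⟦p, A ∩ B ∩ C⟧) :
    0 ≤ sahiE (bernoulliWeight p) 3 ![ind A, ind B, ind C] := by
  rcases h with h | h | h
  · exact sahiE_three_ind_nonneg_of_mul_le_inter₃ p hA hB hC h
  · rw [← sahiE_three_ind_swap₁₂]
    refine sahiE_three_ind_nonneg_of_mul_le_inter₃ p hA hC hB ?_
    have e : A ∩ C ∩ B = A ∩ B ∩ C := by
      ext ω; simp only [Set.mem_inter_iff]; tauto
    rwa [e]
  · rw [← sahiE_three_ind_cycle]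
    refine sahiE_three_ind_nonneg_of_mul_le_inter₃ p hB hC hA ?_
    have e : B ∩ C ∩ A = A ∩ B ∩ C := by
      ext ω; simp only [Set.mem_inter_iff]; tauto
    rwa [e]

/-- The same in the programme's `Fin 3`-family vocabulary (`MasterFamilyNonneg 3` restricted to the region). [this work] -/
theorem sahiE_three_nonneg_of_exists_pair (p : ι → unitInterval) (U : Fin 3 → Set (Set ι)) (hU : ∀ j, IsUpperSet (U j))
    (h : μ⟦p, U 0⟧ * μ⟦p, U 1⟧ ≤ μ⟦p, U 0 ∩ U 1 ∩ U 2⟧ ∨ μ⟦p, U 0⟧ * μ⟦p, U 2⟧ ≤ μ⟦p, U 0 ∩ U 1 ∩ U 2⟧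
      ∨ μ⟦p, U 1⟧ * μ⟦p, U 2⟧ ≤ μ⟦p, U 0 ∩ U 1 ∩ U 2⟧) :
    0 ≤ sahiE (bernoulliWeight p) 3 (fun j => ind (U j)) := by
  have hf : (fun j => ind (U j)) = ![ind (U 0), ind (U 1), ind (U 2)] := by
    ext j ω; fin_cases j <;> rfl
  rw [hf]
  exact sahiE_three_ind_nonneg_of_exists_pair p (hU 0) (hU 1) (hU 2) h

end SahiE3FSplit

end Summit.CriticalPhenomena.PercolationContinuityZ3.Theorems
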